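import Literature.NumberTheory.GaloisRepresentations.ContinuousH1
import Literature.NumberTheory.GaloisRepresentations.GaloisCohomology
import HarnessLib

/-!
# Inflation–restriction in degree one: proof of the named fact `Literature.NumberTheory.GaloisRepresentations.exact_inf_res`

This file discharges the named facts `Literature.NumberTheory.GaloisRepresentations.exact_inf_res` and
`Literature.NumberTheory.GaloisRepresentations.galoisCohomology.inf_one_injective` of
`Literature/NumberTheory/GaloisRepresentations/GaloisCohomology.lean`, i.e. exactness of
`0 → H¹(Γ_K ⧸ Γ_E, M^{Γ_E}) →(inf) H¹(K, M) →(res) H¹(E, M)` at its first two places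
(Neukirch–Schmidt–Wingberg, *Cohomology of Number Fields*, (1.6.7): the five-term exact
sequence `0 → H¹(G/H, A^H) → H¹(G, A) → H¹(H, A)^{G/H} → H²(G/H, A^H) → H²(G, A)` for a closed
normal subgroup `H` of a profinite group `G`; Serre, *Galois Cohomology*, Ch. I §2.6(b)):

* `Literature.exact_inf_res_holds K M : exact_inf_res K M` — for every discrete `Γ_K`-module `ρ` on `M`
  and every normal subextension `E/K` of `K̄/K`, the sequence
  `H¹(Γ_K ⧸ Γ_E, M^{Γ_E}) →(inf) H¹(K, M) →(res) H¹(E, M)` is exact at `H¹(K, M)`;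
* `Literature.galoisCohomology.inf_one_injective_holds K M : galoisCohomology.inf_one_injective K M` —
  `inf : H¹(Γ_K ⧸ S, M^S) → H¹(K, M)` is injective for every (closed) normal subgroup `S ⊴ Γ_K`.

The proof is the standard computation with inhomogeneous continuous cocycles (e.g. Hida,
*Modular Forms and Galois Cohomology*, §4.3.4, (4.25) and Exercise 1), carried out through the
explicit description of Mathlib's `continuousCohomology 1` by continuous crossed homomorphisms
from `Literature/NumberTheory/GaloisRepresentations/ContinuousH1.lean` (`Literature.NumberTheory.GaloisRepresentations.contOneCocycles`,
`Literature.NumberTheory.GaloisRepresentations.oneCocycleClass`, `oneCocycleClass_surjective`, `oneCocycleClass_eq_zero_iff`,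
`map_oneCocycleClass`).  It is organised in two layers:

* `Literature.NumberTheory.GaloisRepresentations.ContinuousCohomology.exact_inf_res_one`: the general inflation–restriction statement in
  degree one for a topological `G`-module `X` with continuous orbit maps, a normal subgroup
  `S ⊴ G`, a topological `G ⧸ S`-module `XQ` embedded `G`-equivariantly into `X` with image
  containing `X^S`, and a continuous homomorphism `φ : H → G` with image exactly `S` together
  with an `H`-equivariant continuous bijection `f : res φ X → Y`; and
  `Literature.NumberTheory.GaloisRepresentations.ContinuousCohomology.inf_one_injective`: injectivity of `H¹(G ⧸ S, XQ) → H¹(G, X)` under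
  the algebraic part of these hypotheses;
* the Galois-theoretic input that the restriction `Γ_E → Γ_K` (`Literature.absGaloisRestrict K E`)
  has image exactly `Gal(K̄/E) = Literature.absGaloisFixingSubgroup E` when `E ⊆ K̄` is normal over
  `K` (`Literature.NumberTheory.GaloisRepresentations.absGaloisRestrict_mem_absGaloisFixingSubgroup`, `Literature.NumberTheory.GaloisRepresentations.exists_absGaloisRestrict_eq`,
  `Literature.NumberTheory.GaloisRepresentations.range_absGaloisRestrict_eq_absGaloisFixingSubgroup`).  Cross-references: for a general
  algebraic `L/K` the image is the fixing group of *some* copy of `L` in `K̄`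
  (`Literature.NumberTheory.GaloisRepresentations.exists_mem_range_absGaloisRestrict_iff` in `ArtinRestriction.lean`,
  `Literature.NumberTheory.EllipticCurves.mem_range_absGaloisRestrict_iff` in `EllipticCurves/ZpExtensionProofs.lean`); here the
  copy is `E` itself because `E/K` is normal.

The sibling file `GaloisCohomologyProofs.lean` discharges the other named facts of
`GaloisCohomology.lean` (Hilbert 90, `Literature.NumberTheory.GaloisRepresentations.subsingleton_galoisCohomology_units_one`, and
inflation from finite Galois quotients, `Literature.NumberTheory.GaloisRepresentations.galoisCohomology.exists_inf_eq_one`); the two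
files are independent of each other.

## References

* J. Neukirch, A. Schmidt, K. Wingberg, *Cohomology of Number Fields* (2008), (1.6.7).
* J.-P. Serre, *Galois Cohomology* (1997), Ch. I §2.6.
* H. Hida, *Modular Forms and Galois Cohomology* (2000), §4.3.4, Thm. 4.33 and (4.25).
* S. Shatz, *Profinite Groups, Arithmetic, and Geometry* (1972), Ch. II §4, (25).
-/

noncomputable section

open CategoryTheory ContRepresentation TopRep Topology Field

namespace Literature.NumberTheory.GaloisRepresentations

universe u v

/-! ### Inflation–restriction in degree one for topological modules -/

namespace ContinuousCohomology

variable {k : Type u} [Ring k] [TopologicalSpace k]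
  {G H : Type v} [Group G] [TopologicalSpace G] [IsTopologicalGroup G]
  [Group H] [TopologicalSpace H] [IsTopologicalGroup H]
  {X : TopRep.{v} k G} {Y : TopRep.{v} k H} (S : Subgroup G) [S.Normal]

/-- **Inflation–restriction in degree one** for Mathlib's continuous cohomology.  Let `X` be a
topological `G`-module with continuous orbit maps `g ↦ g • m`, `S ⊴ G` a normal subgroup,
`XQ` a topological `G ⧸ S`-module with a `G`-equivariant topological embedding `ι : XQ → X`
whose image contains `X^S`, `φ : H →ₜ* G` a continuous homomorphism with image exactly `S`,
and `f : res φ X ⟶ Y` an `H`-equivariant continuous bijection.  Then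
`H¹(G ⧸ S, XQ) →(inf) H¹(G, X) →(res) H¹(H, Y)` is exact at `H¹(G, X)`, where
`inf = ContinuousCohomology.map (G → G ⧸ S) ι 1` and `res = ContinuousCohomology.map φ f 1`.
Proof on continuous crossed homomorphisms `c : G → X` (`Literature.NumberTheory.GaloisRepresentations.oneCocycleClass`): `res ∘ inf = 0`
because an inflated cocycle vanishes on `φ(H) ⊆ S`; conversely, if `res [c] = 0`, i.e.
`f (c (φ h)) = h • v - v` for some `v = f m`, then `c s = s • m - m` on `S = φ(H)`, so
`c' = c - (g ↦ g • m - m)` vanishes on `S`, is constant on the cosets `gS`, takes `S`-invariant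
values (normality), and descends to a continuous crossed homomorphism `G ⧸ S → XQ` (quotient
map, embedding) whose inflation is `c'`.
Ref: Serre, *Galois Cohomology* (1997), Ch. I §2.6(b); Hida, *Modular Forms and Galois
Cohomology* (2000), §4.3.4 (4.25); Neukirch–Schmidt–Wingberg (2008), (1.6.7).
[cite: NeukirchSchmidtWingberg2008, (1.6.7)] -/
theorem exact_inf_res_one {XQ : TopRep.{v} k (G ⧸ S)}
    (ι : res (ContinuousMonoidHom.quotientMk S : G →* G ⧸ S) XQ ⟶ X) (φ : H →ₜ* G)
    (f : res (φ : H →* G) X ⟶ Y)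
    (hι : Function.Injective ι.hom) (hιi : IsInducing ι.hom)
    (hιS : ∀ m : X, (∀ s ∈ S, X.ρ s m = m) → m ∈ Set.range ι.hom)
    (hφ : ∀ h, φ h ∈ S) (hSφ : ∀ s ∈ S, ∃ h, φ h = s)
    (hf : Function.Bijective f.hom) (hX : ∀ m : X, Continuous fun g => X.ρ g m) :
    Function.Exact (ContinuousCohomology.map (ContinuousMonoidHom.quotientMk S) ι 1).hom
      (ContinuousCohomology.map φ f 1).hom := by
  intro y
  constructor
  · -- `ker res ⊆ im inf`
    intro hy
    obtain ⟨c, rfl⟩ := oneCocycleClass_surjective X y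
    have h1 : (ContinuousCohomology.map φ f 1).hom (oneCocycleClass X c) =
        oneCocycleClass Y (contOneCocycles.pullback φ f c) :=
      map_oneCocycleClass X φ f c
    rw [h1, oneCocycleClass_eq_zero_iff] at hy
    obtain ⟨v, hv⟩ := hy
    obtain ⟨m, rfl⟩ := hf.2 v
    -- `c s = s • m - m` on `S = φ(H)`
    have hcS : ∀ s ∈ S, c.1 s = X.ρ s m - m := by
      intro s hs
      obtain ⟨h, rfl⟩ := hSφ s hs
      apply hf.1
      rw [← contOneCocycles.pullback_apply X φ f c h, hv h, map_sub, ← hom_comm_apply f h m]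
      rfl
    -- the principal crossed homomorphism `g ↦ g • m - m`
    let cb : contOneCocycles X :=
      ⟨⟨fun g => X.ρ g m - m, (hX m).sub continuous_const⟩, fun g h => by
        change X.ρ (g * h) m - m = (X.ρ g m - m) + X.ρ g (X.ρ h m - m)
        rw [map_sub, map_mul]
        change X.ρ g (X.ρ h m) - m = (X.ρ g m - m) + (X.ρ g (X.ρ h m) - X.ρ g m)
        abel⟩
    have hcb : oneCocycleClass X cb = 0 :=
      (oneCocycleClass_eq_zero_iff X cb).mpr ⟨m, fun _ => rfl⟩
    -- the cohomologous cocycle `c' = c - cb` vanishes on `S`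
    set c' : contOneCocycles X := c - cb with hc'def
    have hc'_apply : ∀ g, c'.1 g = c.1 g - (X.ρ g m - m) := fun _ => rfl
    have hc'S : ∀ s ∈ S, c'.1 s = 0 := by
      intro s hs
      rw [hc'_apply, hcS s hs, sub_self]
    -- hence is constant on the cosets `gS` …
    have hc'_mul : ∀ g : G, ∀ s ∈ S, c'.1 (g * s) = c'.1 g := by
      intro g s hs
      rw [c'.2, hc'S s hs, map_zero, add_zero]
    -- … and takes `S`-invariant values (`S` is normal)
    have hc'_fix : ∀ g : G, ∀ s ∈ S, X.ρ s (c'.1 g) = c'.1 g := by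
      intro g s hs
      have h7 : s * g = g * (g⁻¹ * s * g) := by simp [mul_assoc]
      have h8 : g⁻¹ * s * g ∈ S := by simpa using Subgroup.Normal.conj_mem inferInstance s hs g⁻¹
      have h9 := c'.2 s g
      rw [hc'S s hs, zero_add, h7, hc'_mul g _ h8] at h9
      exact h9.symm
    -- descend `c'` to a continuous function `t₀ : G ⧸ S → X` (quotient topology)
    let t₀ : G ⧸ S → X := fun q => c'.1 q.out
    have ht₀ : ∀ g : G, t₀ (g : G ⧸ S) = c'.1 g := by
      intro g
      obtain ⟨s, hs⟩ := QuotientGroup.mk_out_eq_mul S g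
      change c'.1 (Quotient.out (g : G ⧸ S)) = c'.1 g
      rw [hs, hc'_mul g s s.2]
    have ht₀_cont : Continuous t₀ := by
      rw [(QuotientGroup.isQuotientMap_mk S).continuous_iff, show t₀ ∘ QuotientGroup.mk = c'.1
        from funext ht₀]
      exact c'.1.continuous
    -- lift its values into `XQ` through the embedding `ι`
    have ht₀_mem : ∀ q : G ⧸ S, t₀ q ∈ Set.range ι.hom := by
      intro q
      obtain ⟨g, rfl⟩ := QuotientGroup.mk_surjective q
      rw [ht₀]
      exact hιS _ (fun s hs => hc'_fix g s hs)
    choose t₁ ht₁ using ht₀_mem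
    have ht₁_cont : Continuous t₁ := by
      rw [hιi.continuous_iff, show ι.hom ∘ t₁ = t₀ from funext ht₁]
      exact ht₀_cont
    let t : C(G ⧸ S, XQ) := ⟨t₁, ht₁_cont⟩
    have hιt : ∀ g : G, ι.hom (t (g : G ⧸ S)) = c'.1 g := fun g => (ht₁ _).trans (ht₀ g)
    -- `t` is a continuous crossed homomorphism of the `G ⧸ S`-module `XQ`
    have ht : t ∈ contOneCocycles XQ := by
      intro p q
      obtain ⟨a, rfl⟩ := QuotientGroup.mk_surjective p
      obtain ⟨b, rfl⟩ := QuotientGroup.mk_surjective q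
      apply hι
      have h10 : ι.hom (XQ.ρ (a : G ⧸ S) (t b)) = X.ρ a (ι.hom (t b)) := hom_comm_apply ι a _
      rw [← QuotientGroup.mk_mul, map_add, h10, hιt, hιt, hιt, c'.2]
    -- its inflation is `c'`
    have hpull : contOneCocycles.pullback (ContinuousMonoidHom.quotientMk S) ι ⟨t, ht⟩ = c' :=
      Subtype.ext (ContinuousMap.ext fun g => hιt g)
    refine ⟨oneCocycleClass XQ ⟨t, ht⟩, ?_⟩
    have h2 : (ContinuousCohomology.map (ContinuousMonoidHom.quotientMk S) ι 1).hom
        (oneCocycleClass XQ ⟨t, ht⟩) =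
        oneCocycleClass X (contOneCocycles.pullback (ContinuousMonoidHom.quotientMk S) ι ⟨t, ht⟩) :=
      map_oneCocycleClass XQ _ ι _
    rw [h2, hpull, hc'def, oneCocycleClass_sub, hcb, sub_zero]
  · -- `res ∘ inf = 0`: an inflated cocycle vanishes on `φ(H) ⊆ S`
    rintro ⟨x, rfl⟩
    obtain ⟨ψ, rfl⟩ := oneCocycleClass_surjective XQ x
    have h1 : (ContinuousCohomology.map (ContinuousMonoidHom.quotientMk S) ι 1).hom
        (oneCocycleClass XQ ψ) =
        oneCocycleClass X (contOneCocycles.pullback (ContinuousMonoidHom.quotientMk S) ι ψ) :=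
      map_oneCocycleClass XQ _ ι ψ
    have h2 : (ContinuousCohomology.map φ f 1).hom
        (oneCocycleClass X (contOneCocycles.pullback (ContinuousMonoidHom.quotientMk S) ι ψ)) =
        oneCocycleClass Y (contOneCocycles.pullback φ f
          (contOneCocycles.pullback (ContinuousMonoidHom.quotientMk S) ι ψ)) :=
      map_oneCocycleClass X φ f _
    have h3 : contOneCocycles.pullback φ f
        (contOneCocycles.pullback (ContinuousMonoidHom.quotientMk S) ι ψ) = 0 := by
      refine Subtype.ext (ContinuousMap.ext fun h => ?_)
      change f.hom (ι.hom (ψ.1 (ContinuousMonoidHom.quotientMk S (φ h)))) = 0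
      rw [show ContinuousMonoidHom.quotientMk S (φ h) = 1 from
        (QuotientGroup.eq_one_iff _).mpr (hφ h), contOneCocycles.apply_one, map_zero, map_zero]
    rw [h1, h2, h3, oneCocycleClass_zero]

/-- **Injectivity of inflation in degree one** for Mathlib's continuous cohomology: with `X`,
`S ⊴ G`, `XQ` and the `G`-equivariant injection `ι : XQ → X` with image containing `X^S` as in
`exact_inf_res_one` (no topological hypotheses are needed here), the inflation map
`H¹(G ⧸ S, XQ) → H¹(G, X)`, `ContinuousCohomology.map (G → G ⧸ S) ι 1`, is injective: if the
inflation of a crossed homomorphism `ψ : G ⧸ S → XQ` is principal, `ι (ψ ḡ) = g • v - v`, then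
`v ∈ X^S` (take `g ∈ S`), so `v = ι w` and `ψ q = q • w - w` is principal.
Ref: Serre, *Galois Cohomology* (1997), Ch. I §2.6(b); Neukirch–Schmidt–Wingberg (2008),
(1.6.7). [cite: NeukirchSchmidtWingberg2008, (1.6.7)] -/
theorem inf_one_injective {XQ : TopRep.{v} k (G ⧸ S)}
    (ι : res (ContinuousMonoidHom.quotientMk S : G →* G ⧸ S) XQ ⟶ X)
    (hι : Function.Injective ι.hom)
    (hιS : ∀ m : X, (∀ s ∈ S, X.ρ s m = m) → m ∈ Set.range ι.hom) :
    Function.Injective (ContinuousCohomology.map (ContinuousMonoidHom.quotientMk S) ι 1).hom := by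
  refine (injective_iff_map_eq_zero _).mpr fun x hx => ?_
  obtain ⟨ψ, rfl⟩ := oneCocycleClass_surjective XQ x
  have h1 : (ContinuousCohomology.map (ContinuousMonoidHom.quotientMk S) ι 1).hom
      (oneCocycleClass XQ ψ) =
      oneCocycleClass X (contOneCocycles.pullback (ContinuousMonoidHom.quotientMk S) ι ψ) :=
    map_oneCocycleClass XQ _ ι ψ
  rw [h1, oneCocycleClass_eq_zero_iff] at hx
  obtain ⟨v, hv⟩ := hx
  -- `v` is `S`-invariant, hence of the form `ι w`
  have hvS : ∀ s ∈ S, X.ρ s v = v := by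
    intro s hs
    have h2 := hv s
    rw [contOneCocycles.pullback_apply, show ContinuousMonoidHom.quotientMk S s = 1 from
      (QuotientGroup.eq_one_iff _).mpr hs, contOneCocycles.apply_one, map_zero] at h2
    exact (sub_eq_zero.mp h2.symm)
  obtain ⟨w, rfl⟩ := hιS v hvS
  rw [oneCocycleClass_eq_zero_iff]
  refine ⟨w, fun q => ?_⟩
  obtain ⟨g, rfl⟩ := QuotientGroup.mk_surjective q
  apply hι
  have h3 := hv g
  rw [contOneCocycles.pullback_apply] at h3
  have h4 : ι.hom (XQ.ρ (g : G ⧸ S) w) = X.ρ g (ι.hom w) := hom_comm_apply ι g w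
  rw [map_sub, h4]
  exact h3

end ContinuousCohomology

/-! ### The image of `Γ_E → Γ_K` for a normal subextension `E/K` of `K̄/K` -/

section Galois

variable (K : Type u) [Field K] (E : IntermediateField K (AlgebraicClosure K)) [Normal K E]

/-- For a normal subextension `E ⊆ K̄` of `K`, the restriction `Γ_E → Γ_K`
(`absGaloisRestrict K E`, along the chosen `K`-embedding `K̄ → Ē`) takes values in
`Gal(K̄/E) = absGaloisFixingSubgroup E`: the embedding maps `E ⊆ K̄` onto the canonical copy
of `E` in `Ē` (normality, `AlgHom.restrictNormal`), which `Γ_E` fixes.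
Ref: Neukirch, *Algebraic Number Theory*, Ch. IV §1. [folklore] -/
lemma absGaloisRestrict_mem_absGaloisFixingSubgroup (σ : absoluteGaloisGroup E) :
    absGaloisRestrict K E σ ∈ absGaloisFixingSubgroup E := by
  rw [mem_absGaloisFixingSubgroup_iff]
  intro x hx
  apply (absClosureEmbedding K E).toRingHom.injective
  change absClosureEmbedding K E _ = absClosureEmbedding K E x
  rw [absGaloisRestrict_apply_smul]
  have hx' : absClosureEmbedding K E x =
      algebraMap E (AlgebraicClosure E) ((absClosureEmbedding K E).restrictNormal E ⟨x, hx⟩) := by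
    rw [AlgHom.restrictNormal_commutes]
    rfl
  rw [hx', absoluteGaloisGroup.smul_def, AlgEquiv.commutes]

/-- For a normal subextension `E ⊆ K̄` of `K`, every element of `Gal(K̄/E)` is the restriction
of an element of `Γ_E = Gal(Ē/E)`: the chosen embedding `K̄ → Ē` is an isomorphism (both
sides are algebraic closures of `K`), and conjugating `τ ∈ Gal(K̄/E)` by it gives an
`E`-linear automorphism of `Ē`.  Together with
`absGaloisRestrict_mem_absGaloisFixingSubgroup`: the image of `Γ_E → Γ_K` is exactly
`Gal(K̄/E)`.  Ref: Neukirch, *Algebraic Number Theory*, Ch. IV §1. [folklore] -/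
lemma exists_absGaloisRestrict_eq (τ : absoluteGaloisGroup K) (hτ : τ ∈ absGaloisFixingSubgroup E) :
    ∃ σ : absoluteGaloisGroup E, absGaloisRestrict K E σ = τ := by
  rw [mem_absGaloisFixingSubgroup_iff] at hτ
  have hbij : Function.Bijective (absClosureEmbedding K E) :=
    (Algebra.IsAlgebraic.algHom_bijective₂ (absClosureEmbedding K E)
      (IsAlgClosed.lift : AlgebraicClosure E →ₐ[K] AlgebraicClosure K)).1
  let e : AlgebraicClosure K ≃ₐ[K] AlgebraicClosure E :=
    AlgEquiv.ofBijective (absClosureEmbedding K E) hbij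
  have he : ∀ x, e x = absClosureEmbedding K E x := fun _ => rfl
  let rN : E ≃ₐ[K] E := (absClosureEmbedding K E).restrictNormal' E
  have hrN : ∀ z : E, algebraMap E (AlgebraicClosure E) z =
      absClosureEmbedding K E ((rN.symm z : E) : AlgebraicClosure K) := by
    intro z
    have := AlgHom.restrictNormal_commutes (absClosureEmbedding K E) E (rN.symm z)
    have h2 : (absClosureEmbedding K E).restrictNormal E (rN.symm z) = z := by
      change rN (rN.symm z) = z
      exact rN.apply_symm_apply z
    rw [h2] at this
    exact this
  let σ' : AlgebraicClosure E ≃ₐ[K] AlgebraicClosure E :=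
    e.symm.trans ((absoluteGaloisGroup.toAlgEquiv K τ).trans e)
  have hσ' : ∀ y, σ' y = e (τ • e.symm y) := fun _ => rfl
  let σ : AlgebraicClosure E ≃ₐ[E] AlgebraicClosure E :=
    AlgEquiv.ofRingEquiv (f := σ'.toRingEquiv) (fun z => by
      change σ' (algebraMap E (AlgebraicClosure E) z) = algebraMap E (AlgebraicClosure E) z
      rw [hσ', hrN, ← he, AlgEquiv.symm_apply_apply, hτ _ (rN.symm z).2])
  refine ⟨(absoluteGaloisGroup.toAlgEquiv E).symm σ, ?_⟩
  apply eq_of_smul_eq_smul (α := AlgebraicClosure K)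
  intro x
  apply (absClosureEmbedding K E).toRingHom.injective
  change absClosureEmbedding K E _ = absClosureEmbedding K E _
  rw [absGaloisRestrict_apply_smul, absoluteGaloisGroup.toAlgEquiv_symm_apply]
  change σ' (absClosureEmbedding K E x) = _
  rw [hσ', ← he, AlgEquiv.symm_apply_apply, he]

/-- The image of `Γ_E → Γ_K` is `Gal(K̄/E)` for `E/K` normal (set form of the two previous
lemmas).  Ref: Neukirch, *Algebraic Number Theory*, Ch. IV §1. [folklore] -/
theorem range_absGaloisRestrict_eq_absGaloisFixingSubgroup :
    Set.range (absGaloisRestrict K E) = (absGaloisFixingSubgroup E : Set (absoluteGaloisGroup K)) :=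
  Set.ext fun τ => ⟨fun ⟨σ, hσ⟩ => hσ ▸ absGaloisRestrict_mem_absGaloisFixingSubgroup K E σ,
    fun hτ => exists_absGaloisRestrict_eq K E τ hτ⟩

end Galois

/-! ### The named fact -/

section Main

variable (K : Type u) [Field K] (M : Type u) [AddCommGroup M] [TopologicalSpace M]
  [DiscreteTopology M]

/-- **Inflation–restriction in degree one** (discharge of the named fact `Literature.NumberTheory.GaloisRepresentations.exact_inf_res`):
for every discrete `Γ_K`-module `M` and every normal subextension `E/K` of `K̄/K`, the
sequence `H¹(Γ_K ⧸ Γ_E, M^{Γ_E}) →(inf) H¹(K, M) →(res) H¹(E, M)` is exact at `H¹(K, M)`.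
Obtained from the general statement `ContinuousCohomology.exact_inf_res_one` with `G = Γ_K`,
`S = Γ_E = absGaloisFixingSubgroup E`, `XQ = M^{Γ_E}` (`quotientInvariants`), `H = Γ_E` the
absolute Galois group of the field `E` and `φ = absGaloisRestrict K E`, whose image is `Γ_E`
(`range_absGaloisRestrict_eq_absGaloisFixingSubgroup`); orbit maps of a discrete Galois module
are continuous (`ContinuousRep.continuous_apply_left`).
Ref: Neukirch–Schmidt–Wingberg, *Cohomology of Number Fields* (2008), (1.6.7); Serre,
*Galois Cohomology* (1997), Ch. I §2.6(b). [cite: NeukirchSchmidtWingberg2008, (1.6.7)] -/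
theorem exact_inf_res_holds : exact_inf_res K M := by
  intro ρ E _
  exact ContinuousCohomology.exact_inf_res_one (absGaloisFixingSubgroup E) (X := ρ.toTopRep)
    (XQ := (ρ.quotientInvariants (absGaloisFixingSubgroup E)).toTopRep)
    (Y := DiscreteGaloisModule.toTopRep (ContinuousRep.restrict ρ (absGaloisRestrict K E)))
    (TopRep.ofHom ⟨Submodule.subtypeL _, fun _ => rfl⟩) (absGaloisRestrict K E)
    (TopRep.ofHom ⟨ContinuousLinearMap.id ℤ M, fun _ => rfl⟩)
    Subtype.val_injective IsInducing.subtypeVal (fun m hm => ⟨⟨m, fun s => hm s.1 s.2⟩, rfl⟩)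
    (absGaloisRestrict_mem_absGaloisFixingSubgroup K E) (exists_absGaloisRestrict_eq K E)
    Function.bijective_id (fun m => ρ.continuous_apply_left m)

/-- **Injectivity of inflation in degree one** (discharge of the named fact
`Literature.NumberTheory.GaloisRepresentations.galoisCohomology.inf_one_injective`): for every discrete `Γ_K`-module `M` and every closed
normal subgroup `S ⊴ Γ_K`, `inf : H¹(Γ_K ⧸ S, M^S) → H¹(K, M)` is injective.  From
`ContinuousCohomology.inf_one_injective`; the closedness hypothesis of the fact is not used.
Ref: Neukirch–Schmidt–Wingberg, *Cohomology of Number Fields* (2008), (1.6.7); Serre,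
*Galois Cohomology* (1997), Ch. I §2.6(b). [cite: NeukirchSchmidtWingberg2008, (1.6.7)] -/
theorem galoisCohomology.inf_one_injective_holds : galoisCohomology.inf_one_injective K M := by
  intro ρ S _ _
  exact ContinuousCohomology.inf_one_injective S (X := ρ.toTopRep)
    (XQ := (ρ.quotientInvariants S).toTopRep) (TopRep.ofHom ⟨Submodule.subtypeL _, fun _ => rfl⟩)
    Subtype.val_injective (fun m hm => ⟨⟨m, fun s => hm s.1 s.2⟩, rfl⟩)

end Main

end Literature.NumberTheory.GaloisRepresentations

end
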